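import Summits.PneNP.PneNP.Theorems.ExpanderLinearGeneratorsGridRoutingChains

/-!
# PneNP / ExpanderLinearGenerators — every substituted clause of the grid routing system follows
from `¬⋀ontoPHP` (grid routing reduction, clauses)

Route `PneNP/ExpanderLinearGenerators`, support for crux stmt-PneNP-11443. Fifth file of the
Urquhart–Fu / Ben-Sasson reduction (`R' = ⋀ ontoPHP^{k+2}_{k+1}`, `σ = routeSubst k`):

* `gridClauseS` — for every clause `K` of the equation of a grid point `g(u,w)`: `⊢ σ(K), ¬R'`
  (skeleton step `skeletonStep2S` from the exclusions `rowExclS` / `colExclS` at `(u,w)`, whose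
  tautology is `skel_tautology_grid`, recomposed by `subst_skelSubst_fillSubst`);
* `pigeonClauseS`, `holeClauseS` — the same for the terminal equations, from the pigeon / onto
  clause of the terminal (`rowOR_zero`, `colOR_zero`);
* `gridSystemClauseS` — hence `⊢ σ(K), ¬R'` for EVERY clause `K` of
  `sumEncoding 1 (gridSystem k)`, in `clauseLines k` lines of size `≤ B`, `B ≥ 3000 (k+3)⁴`.

References: A. Urquhart, X. Fu, NDJFL 37 (1996); E. Ben-Sasson, Comput. Complexity 11 (2002), §3.
-/

namespace Summit.PneNP.PneNP.Theorems.GridRouting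

set_option linter.dupNamespace false -- `Summit.PneNP.PneNP.…`: summit = sub-problem (D-0017)

open Finset Literature.Computability.Complexity.PropForm
open Literature.Computability.Complexity (PropForm Clause CNF Literal eventually_pow_lt_two_rpow_rpow)
open Literature.Computability.MetaComplexity Literature.Computability.MetaComplexity.TextbookFrege
open Literature.Computability.MetaComplexity.KrajicekRamsey (litOf clauseOf ofCNF_eq_conjList
  subst_disjList size_subst_le altDepthAux_subst_le dd_clauseOf_le clauseExtractS dd_neg_ofCNF_le)

variable {k : ℕ}

/-! ### Small syntactic facts -/

/-- Variables of a rendered clause are first components of its literals. [folklore] -/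
theorem exists_literal_of_mem_vars_clauseOf {c : Clause ℕ} {x : ℕ} (h : x ∈ (clauseOf c).vars) :
    ∃ l ∈ c, l.1 = x := by
  induction c with
  | nil => simp [clauseOf_nil, PropForm.vars] at h
  | cons l c ih =>
    rw [clauseOf_cons, PropForm.vars, Finset.mem_union] at h
    rcases h with h | h
    · refine ⟨l, List.mem_cons_self, ?_⟩
      unfold litOf at h
      split_ifs at h <;>
        · simp only [PropForm.vars, Finset.mem_singleton] at h; exact h.symm
    · obtain ⟨l', hl', rfl⟩ := ih h
      exact ⟨l', List.mem_cons_of_mem _ hl', rfl⟩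

/-- A clause of an equation of the grid system has at most `4` literals. [folklore] -/
theorem length_le_of_mem_equationCNF {r : RowIdx k} {K : Clause ℕ}
    (hK : K ∈ equationCNF 1 (gridSystem k (rowEquiv k r))) : K.length ≤ 4 := by
  rw [equationCNF] at hK
  rw [length_of_mem_canonicalCNF hK, length_eqVars, mul_one]
  exact card_supp_gridSystem_le k _

/-- Hence its rendering has size at most `13`. [folklore] -/
theorem size_clauseOf_le_of_mem_equationCNF {r : RowIdx k} {K : Clause ℕ}
    (hK : K ∈ equationCNF 1 (gridSystem k (rowEquiv k r))) : (clauseOf K).size ≤ 13 := by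
  have := size_clauseOf_le K
  have := length_le_of_mem_equationCNF hK
  omega

/-- The variables of the skeleton values at a grid point. [folklore] -/
theorem vars_skelOf (u : Fin (k + 2)) (w : Fin (k + 1)) (e : VarIdx k) {x : ℕ}
    (hx : x ∈ (skelOf k u w e).vars) : x ∈ [0, 1, 2] := by
  rcases e with ⟨a, b⟩ | ⟨a, b⟩ <;> simp only [skelOf] at hx <;> split_ifs at hx <;>
    simp_all [PropForm.vars] <;> omega

/-- Sizes of the skeleton values at a grid point. [folklore] -/
theorem size_skelOf_le (u : Fin (k + 2)) (w : Fin (k + 1)) (e : VarIdx k) :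
    (skelOf k u w e).size ≤ 3 := by
  rcases e with ⟨a, b⟩ | ⟨a, b⟩ <;> simp only [skelOf] <;> split_ifs <;> simp [size]

/-- Depths of the skeleton values at a grid point. [folklore] -/
theorem altDepthAux_skelOf_le (u : Fin (k + 2)) (w : Fin (k + 1)) (e : VarIdx k) (c : ℕ) :
    altDepthAux c (skelOf k u w e) ≤ 1 := by
  have h1 := altDepthAux_le_dd_succ c (skelOf k u w e)
  have h0 : (skelOf k u w e).dd = 0 := by
    rcases e with ⟨a, b⟩ | ⟨a, b⟩ <;> simp only [skelOf] <;> split_ifs <;> simp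
  omega

/-- The same three facts for the skeleton substitution. [folklore] -/
theorem vars_skelSubst (u : Fin (k + 2)) (w : Fin (k + 1)) (y : ℕ) {x : ℕ}
    (hx : x ∈ (skelSubst k u w y).vars) : x ∈ [0, 1, 2] := by
  unfold skelSubst at hx
  split_ifs at hx with h
  · exact vars_skelOf u w _ hx
  · simp [PropForm.vars] at hx

/-- Size of the skeleton substitution. [folklore] -/
theorem size_skelSubst_le (u : Fin (k + 2)) (w : Fin (k + 1)) (y : ℕ) :
    (skelSubst k u w y).size ≤ 3 := by
  unfold skelSubst; split_ifs
  · exact size_skelOf_le u w _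
  · simp [size]

/-- Depth of the skeleton substitution. [folklore] -/
theorem altDepthAux_skelSubst_le (u : Fin (k + 2)) (w : Fin (k + 1)) (y c : ℕ) :
    altDepthAux c (skelSubst k u w y) ≤ 1 := by
  unfold skelSubst; split_ifs
  · exact altDepthAux_skelOf_le u w _ c
  · simp

variable (k)

variable {k}

/-- A chain has at least `5` lines... precisely: chains grow with their length. [folklore] -/
theorem chainLines_mono : ∀ {t t' : ℕ}, t ≤ t' → chainLines k t ≤ chainLines k t'
  | t, 0, h => by rw [Nat.le_zero.1 h]
  | t, t' + 1, h => by
    rcases Nat.lt_or_eq_of_le h with h | h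
    · have := chainLines_mono (Nat.le_of_lt_succ h)
      rw [chainLines]
      unfold stepLines
      omega
    · rw [h]

/-! ### Grid points -/

/-- **Every substituted clause of a grid point follows from `¬⋀ontoPHP`.** For a clause `K` of the
equation of `g(u,w)`: `⊢ σ(K), ¬R'` — the skeleton step from the two exclusions
`¬p_{uw} ∨ ¬rowOR k u (w+1)` (functionality) and `¬p_{uw} ∨ ¬colOR k (u+1) w` (injectivity).
[Ben-Sasson 2002, §3; Urquhart–Fu 1996] [folklore] -/
theorem gridClauseS {D B : ℕ} (hD : 13 ≤ D) (hB : 3000 * (k + 3) ^ 4 ≤ B) (u : Fin (k + 2))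
    (w : Fin (k + 1)) {K : Clause ℕ}
    (hK : K ∈ equationCNF 1 (gridSystem k (rowEquiv k (Sum.inr (Sum.inr (u, w)))))) :
    BD D B (clauseLines k)
      (disjList [(clauseOf K).subst (routeSubst k), neg (ontoPhp (k + 1))]) := by
  have hszR := size_ontoPhp_le (k + 1)
  -- the two exclusions, padded to the common line count
  have hrow : BD D B (maxChainLines k)
      (disjList [rowExcl k u w (w + 1), neg (ontoPhp (k + 1))]) :=
    (rowExclS hD hB (k - w) u w (w + 1) u.2 (Nat.lt_succ_self _) (by omega)).mono
      (chainLines_mono (by omega))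
  have hcol : BD D B (maxChainLines k)
      (disjList [colExcl k u w (u + 1), neg (ontoPhp (k + 1))]) :=
    (colExclS hD hB (k + 1 - u) u w (u + 1) w.2 (Nat.lt_succ_self _) (by omega)).mono
      (chainLines_mono (by omega))
  -- the skeleton step
  have hstep := skeletonStep2S (D := D) (B := B) (R' := ontoPhp (k + 1))
    (Dsk := (clauseOf K).subst (skelSubst k u w)) (G₁ := disj (neg (var 0)) (neg (var 1)))
    (G₂ := disj (neg (var 0)) (neg (var 2))) (θ := fillSubst k u w) [0, 1, 2] (by decide)
    (by simp) ?_ ?_ ?_ ?_ (Z₁ := Z₁ k) (SR := SR k) (size_fillSubst_le u w) (by simp)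
    (altDepthAux_fillSubst_le u w) (dd_neg_ontoPhp_le _) (by simpa using hszR)
    (by simpa [rowExcl, PropForm.subst, fillSubst] using hrow)
    (by simpa [colExcl, PropForm.subst, fillSubst] using hcol) hD (stepB_of_le k hB)
  · -- recompose the substitution
    have e : ((clauseOf K).subst (skelSubst k u w)).subst (fillSubst k u w) =
        (clauseOf K).subst (routeSubst k) := by
      rw [PropForm.subst_subst]
      refine PropForm.subst_congr fun x hx => ?_
      obtain ⟨l, hl, rfl⟩ := exists_literal_of_mem_vars_clauseOf hx
      obtain ⟨e, he, hle⟩ := exists_edge_of_mem_equationCNF hK hl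
      rw [hle]
      exact subst_skelSubst_fillSubst u w he
    rw [e] at hstep
    exact hstep
  · -- variables
    intro A hA x hx
    simp only [List.mem_cons, List.not_mem_nil, or_false] at hA
    rcases hA with rfl | rfl | rfl
    · obtain ⟨y, -, hy⟩ := mem_vars_subst hx
      exact vars_skelSubst u w y hy
    · simp [PropForm.vars] at hx; simp; omega
    · simp [PropForm.vars] at hx; simp; omega
  · -- the tautology
    intro τ h1 h2
    refine skel_tautology_grid u w ?_ ?_ hK
    · simp only [PropForm.eval, Bool.or_eq_true, Bool.not_eq_true'] at h1
      rcases h1 with h1 | h1 <;> simp [h1]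
    · simp only [PropForm.eval, Bool.or_eq_true, Bool.not_eq_true'] at h2
      rcases h2 with h2 | h2 <;> simp [h2]
  · -- depths of the skeleton members
    intro A hA
    simp only [List.mem_cons, List.not_mem_nil, or_false] at hA
    rcases hA with rfl | rfl | rfl
    · have h1 := altDepthAux_subst_le (T := 1) (fun y c => altDepthAux_skelSubst_le u w y c)
        (clauseOf K) 0
      have h2 := altDepth_clauseOf_le K
      unfold altDepth at h2 ⊢; omega
    · decide
    · decide
  · -- sizes of the skeleton members
    have h1 := size_subst_le (Z := 3) (size_skelSubst_le u w) (by norm_num) (clauseOf K)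
    have h2 := size_clauseOf_le_of_mem_equationCNF hK
    simp only [msum_cons, msum_nil, size]
    omega

/-! ### Terminals -/

/-- Skeleton step at a terminal: if the clause `K` mentions only the edge numbered `a`, is true
whenever that edge is, and `⊢ Y, ¬R'` where `Y = σ(a)`, then `⊢ σ(K), ¬R'`. [folklore] -/
theorem termClauseS {D B m : ℕ} (hD : 13 ≤ D) (hB : 3000 * (k + 3) ^ 4 ≤ B) {a : ℕ}
    {Y : PropForm ℕ} {K : Clause ℕ} (hKlen : K.length ≤ 4) (hKa : ∀ l ∈ K, l.1 = a)
    (hσa : routeSubst k a = Y) (hYsz : Y.size ≤ Z₁ k) (hYd : ∀ c, altDepthAux c Y ≤ 2)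
    (htaut : ∀ τ : ℕ → Bool, τ 0 = true → ((clauseOf K).subst (termSkel a)).eval τ = true)
    (hyp : BD D B m (disjList [Y, neg (ontoPhp (k + 1))])) :
    BD D B (stepLines m 0)
      (disjList [(clauseOf K).subst (routeSubst k), neg (ontoPhp (k + 1))]) := by
  have hszR := size_ontoPhp_le (k + 1)
  have hstep := skeletonStep1S (D := D) (B := B) (R' := ontoPhp (k + 1))
    (Dsk := (clauseOf K).subst (termSkel a)) (G₁ := var 0) (θ := termFill Y) [0] (by simp)
    (by simp) ?_ ?_ ?_ ?_ (Z₁ := Z₁ k) (SR := SR k) ?_ (by simp) ?_ (dd_neg_ontoPhp_le _)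
    (by simpa using hszR) (by simpa [PropForm.subst, termFill] using hyp) hD (stepB_of_le k hB)
  · have e : ((clauseOf K).subst (termSkel a)).subst (termFill Y) =
        (clauseOf K).subst (routeSubst k) := by
      rw [PropForm.subst_subst]
      refine PropForm.subst_congr fun x hx => ?_
      obtain ⟨l, hl, rfl⟩ := exists_literal_of_mem_vars_clauseOf hx
      rw [hKa l hl, hσa]
      simp [termSkel, termFill, PropForm.subst]
    rw [e] at hstep
    exact hstep
  · intro A hA x hx
    simp only [List.mem_cons, List.not_mem_nil, or_false] at hA
    rcases hA with rfl | rfl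
    · obtain ⟨y, -, hy⟩ := mem_vars_subst hx
      unfold termSkel at hy
      split_ifs at hy <;> simp_all [PropForm.vars]
    · simp_all [PropForm.vars]
  · intro τ h1
    exact htaut τ (by simpa [PropForm.eval] using h1)
  · intro A hA
    simp only [List.mem_cons, List.not_mem_nil, or_false] at hA
    rcases hA with rfl | rfl
    · have h1 := altDepthAux_subst_le (T := 1) (σ := termSkel a)
        (fun y c => by unfold termSkel; split_ifs <;> simp) (clauseOf K) 0
      have h2 := altDepth_clauseOf_le K
      unfold altDepth at h2 ⊢; omega
    · decide
  · have h1 := size_subst_le (Z := 1) (σ := termSkel a)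
      (fun y => by unfold termSkel; split_ifs <;> simp [size]) le_rfl (clauseOf K)
    have h2 := size_clauseOf_le K
    simp only [msum_cons, msum_nil, size]
    omega
  · intro x; unfold termFill; split_ifs
    · exact hYsz
    · simp [size]
  · intro x c; unfold termFill; split_ifs
    · exact hYd c
    · simp

/-- **Every substituted clause of a pigeon terminal follows from `¬⋀ontoPHP`** (from the pigeon
clause of `u`, which IS `σ(r(u,0)) = rowOR k u 0`). [Ben-Sasson 2002, §3] [folklore] -/
theorem pigeonClauseS {D B : ℕ} (hD : 13 ≤ D) (hB : 3000 * (k + 3) ^ 4 ≤ B) (u : Fin (k + 2))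
    {K : Clause ℕ} (hK : K ∈ equationCNF 1 (gridSystem k (rowEquiv k (Sum.inl u)))) :
    BD D B (clauseLines k)
      (disjList [(clauseOf K).subst (routeSubst k), neg (ontoPhp (k + 1))]) := by
  -- the pigeon clause
  have hmem : ((List.range (k + 1)).map fun j => ((u : ℕ) * (k + 1) + j, true)) ∈
      ontoPigeonholeCNF (k + 1 + 1) (k + 1) :=
    mem_ontoPigeonholeCNF_of_mem (KEval.mem_pigeonholeCNF_iff.2 (Or.inl ⟨u, by omega, rfl⟩))
  have hex := ontoClauseExtractS (D := D) (k + 1) hmem (by omega) (extractB_of_le k hB)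
  rw [← rowOR_zero] at hex
  refine (termClauseS hD hB (a := (varEquiv k (Sum.inl (u, 0)) : ℕ)) (Y := rowOR k u 0)
    (length_le_of_mem_equationCNF hK) ?_ ?_ (size_rowOR_le _ _)
    (fun c => altDepthAux_clauseOf_le _ _) (fun τ h0 => skel_tautology_pigeon u h0 hK) hex).mono ?_
  · intro l hl
    obtain ⟨e, he, hle⟩ := exists_edge_of_mem_equationCNF hK hl
    simp only [edgesOf, Finset.mem_singleton] at he
    rw [hle, he]
  · rw [routeSubst_varEquiv]; rfl
  · unfold clauseLines
    refine stepLines_mono ?_ (Nat.zero_le _)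
    unfold maxChainLines
    have := chainLines_mono (k := k) (Nat.zero_le (k + 1))
    rw [chainLines] at this
    have h5 : 1400 * (k + 1 + 2) ^ 4 ≤ chainLines k 1 := by
      rw [chainLines]; unfold stepLines; omega
    exact h5.trans (chainLines_mono (by omega))

/-- **Every substituted clause of a hole terminal follows from `¬⋀ontoPHP`** (from the onto clause
of `w`, which IS `σ(c(0,w)) = colOR k 0 w`). [Ben-Sasson 2002, §3] [folklore] -/
theorem holeClauseS {D B : ℕ} (hD : 13 ≤ D) (hB : 3000 * (k + 3) ^ 4 ≤ B) (w : Fin (k + 1))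
    {K : Clause ℕ} (hK : K ∈ equationCNF 1 (gridSystem k (rowEquiv k (Sum.inr (Sum.inl w))))) :
    BD D B (clauseLines k)
      (disjList [(clauseOf K).subst (routeSubst k), neg (ontoPhp (k + 1))]) := by
  -- the onto clause
  have hmem : ((List.range (k + 1 + 1)).map fun i => (i * (k + 1) + (w : ℕ), true)) ∈
      ontoPigeonholeCNF (k + 1 + 1) (k + 1) :=
    mem_ontoPigeonholeCNF_iff.2 (Or.inr (Or.inr ⟨w, w.2, rfl⟩))
  have hex := ontoClauseExtractS (D := D) (k + 1) hmem (by omega) (extractB_of_le k hB)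
  rw [show k + 1 + 1 = k + 2 by omega, ← colOR_zero] at hex
  refine (termClauseS hD hB (a := (varEquiv k (Sum.inr (0, w)) : ℕ)) (Y := colOR k 0 w)
    (length_le_of_mem_equationCNF hK) ?_ ?_ (size_colOR_le _ _)
    (fun c => altDepthAux_clauseOf_le _ _) (fun τ h0 => skel_tautology_hole w h0 hK) hex).mono ?_
  · intro l hl
    obtain ⟨e, he, hle⟩ := exists_edge_of_mem_equationCNF hK hl
    simp only [edgesOf, Finset.mem_singleton] at he
    rw [hle, he]
  · rw [routeSubst_varEquiv]; rfl
  · unfold clauseLines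
    refine stepLines_mono ?_ (Nat.zero_le _)
    unfold maxChainLines
    have h5 : 1400 * (k + 1 + 2) ^ 4 ≤ chainLines k 1 := by
      rw [chainLines]; unfold stepLines; omega
    exact h5.trans (chainLines_mono (by omega))

/-! ### All clauses of the grid system -/

/-- **Every substituted clause of the grid routing system follows from `¬⋀ontoPHP`**: for every
clause `K` of `sumEncoding 1 (gridSystem k)`, `⊢ σ(K), ¬⋀ontoPHP^{k+2}_{k+1}` in `clauseLines k`
lines of size `≤ B`. [Ben-Sasson 2002, §3; Urquhart–Fu 1996] [folklore] -/
theorem gridSystemClauseS {D B : ℕ} (hD : 13 ≤ D) (hB : 3000 * (k + 3) ^ 4 ≤ B) {K : Clause ℕ}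
    (hK : K ∈ sumEncoding 1 (gridSystem k)) :
    BD D B (clauseLines k)
      (disjList [(clauseOf K).subst (routeSubst k), neg (ontoPhp (k + 1))]) := by
  simp only [sumEncoding, List.mem_flatMap, List.mem_finRange, true_and] at hK
  obtain ⟨i, hi⟩ := hK
  obtain ⟨r, rfl⟩ := (rowEquiv k).surjective i
  rcases r with u | w | ⟨u, w⟩
  · exact pigeonClauseS hD hB u hi
  · exact holeClauseS hD hB w hi
  · exact gridClauseS hD hB u w hi

end Summit.PneNP.PneNP.Theorems.GridRouting
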